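import Literature.NumberTheory.GaloisRepresentations.UnitIdelesHerbrand
import Literature.NumberTheory.Automorphic.IdeleIdealClass
import HarnessLib

/-!
# The Herbrand quotient of the idele class group of a cyclic extension (Childress Thm. 5.11)

Topic `NumberTheory/GaloisRepresentations` (class field theory: Childress, *Class Field Theory*,
Ch. 4 §5 Thm. 5.11 "`Q(C_K) = [K : F]`", PDF pp. 101–102, the heart of the global cyclic norm
index inequality Thm. 5.12); namespace
`Literature.NumberTheory.GaloisRepresentations.IdeleHerbrand`.  Everything **proved**; the two
arithmetic inputs not yet in the tree enter as explicit hypotheses, spelled out inline: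

* `hun₀`, `hun₁` — Childress Prop. 5.7 (iii) (via Lemma 5.3): outside a finite set `S` of finite
  places of `F`, the local units `∏_{w ∣ v} 𝒪_wˣ` have trivial `Ĥ⁰` and `Ĥ⁻¹` (element form);
* `hunits` — Childress Prop. 5.10: `[E : F] · #Ĥ⁰(G, 𝒪_Eˣ) = 2^a · #Ĥ⁻¹(G, 𝒪_Eˣ)` with both sides
  finite and non-zero, for the global units `𝒪_Eˣ = 𝓔_E ∩ Eˣ` inside `J_E` and
  `2^a = ArchHerbrand.archFactor F E`.

## Main results (index language of `CyclicHerbrandQuotient.lean`, `0 = ∞`)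

* `IdeleHerbrand.index_principalIdeles_sup_unitIdeles_ne_zero` — **finiteness of the idele class
  group modulo unit ideles** `[J_E : Eˣ 𝓔_E] < ∞` (= class number; from
  `Automorphic/IdeleIdealClass.lean`).
* `IdeleHerbrand.h0_top_principalIdeles_eq` — **Childress Thm. 5.11 in index form**: for
  `Gal(E/F) = ⟨σ⟩` cyclic of order `n`, under `hun₀`, `hun₁`, `hunits`,
  `#Ĥ⁰(G, C_E) = n · #Ĥ⁻¹(G, C_E)` with `#Ĥ⁻¹(G, C_E) ≠ 0`, where `Ĥⁱ(G, C_E)` is computed on the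
  pair `(J_E, Eˣ)` (`Herbrand.h0 σ ⊤ (principalIdeles E)`): the hexagon (Prop. 4.2) for
  `1 ≤ 𝒪_Eˣ ≤ 𝓔_E`, the second isomorphism `Eˣ𝓔_E/Eˣ ≅ 𝓔_E/𝒪_Eˣ`, and Cor. 4.4 for the finite
  index `[J_E : Eˣ𝓔_E]`.

## References

* N. Childress, *Class Field Theory*, Universitext, Springer 2009, Ch. 4 §5 Thm. 5.11
  (PDF pp. 101–102), Prop. 5.7, Prop. 5.10. [Childress2009]
-/

noncomputable section

open NumberField IsDedekindDomain
open scoped Valued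

namespace Literature.NumberTheory.GaloisRepresentations

namespace IdeleHerbrand

open Literature.NumberTheory.Automorphic

universe u

variable {F : Type u} [Field F] [NumberField F] {E : Type u} [Field E] [NumberField E] [Algebra F E]

/-! ### Finiteness of `J_E / Eˣ 𝓔_E` -/

variable (E) in
/-- The finite-part projection `J_E →* 𝔸_{E,f}ˣ`. [folklore] -/
def finHom : ideleGroup E →* (FiniteAdeleRing (𝓞 E) E)ˣ :=
  Units.map (RingHom.snd (InfiniteAdeleRing E) (FiniteAdeleRing (𝓞 E) E)).toMonoidHom

variable (E) in
/-- The inclusion `𝔸_{E,f}ˣ →* J_E` (`t ↦ (1, t)`). [folklore] -/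
def ofFinite : (FiniteAdeleRing (𝓞 E) E)ˣ →* ideleGroup E :=
  Units.map (MonoidHom.inr (InfiniteAdeleRing E) (FiniteAdeleRing (𝓞 E) E))

omit [NumberField F] [Algebra F E] in
/-- Finite part of `ofFinite t`. [folklore] -/
@[simp] theorem finHom_ofFinite (t : (FiniteAdeleRing (𝓞 E) E)ˣ) : finHom E (ofFinite E t) = t :=
  Units.ext rfl

omit [NumberField F] [Algebra F E] in
/-- Finite part of a principal idele. [folklore] -/
theorem finHom_principal (k : Eˣ) :
    finHom E (Units.map (algebraMap E (AdeleRing (𝓞 E) E) : E →* AdeleRing (𝓞 E) E) k) =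
      FiniteAdeleRing.unitEmbedding (𝓞 E) E k :=
  Units.ext rfl

omit [NumberField F] [Algebra F E] in
/-- An idele whose finite part has order `0` everywhere is a unit idele. [folklore] -/
theorem mem_unitIdeles_of_unitOrd_eq_zero {x : ideleGroup E}
    (h : ∀ w, FiniteAdeleRing.unitOrd (𝓞 E) E (finHom E x) w = 0) : x ∈ unitIdeles E := fun w =>
  (FiniteAdeleRing.unitOrd_eq_zero_iff (finHom E x) w).mp (h w)

omit [NumberField F] [Algebra F E] in
/-- **`[J_E : Eˣ · 𝓔_E] < ∞`** (finiteness of the ideal class group: every finite idele is a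
principal idele times one of finitely many representatives times a unit idele).
[cite: Childress2009, Ch. 4 §5 proof of Thm. 5.11 (PDF p. 102)] -/
theorem index_principalIdeles_sup_unitIdeles_ne_zero :
    (principalIdeles E ⊔ unitIdeles E).index ≠ 0 := by
  classical
  obtain ⟨T, hT⟩ := FiniteAdeleRing.exists_finset_forall_exists_unitOrd_eq_zero (R := 𝓞 E) (K := E)
  set H := principalIdeles E ⊔ unitIdeles E with hH
  -- every coset is represented by some `ofFinite t`, `t ∈ T`
  have hcov : ∀ x : ideleGroup E, ∃ t ∈ T, (ofFinite E t)⁻¹ * x ∈ H := by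
    intro x
    obtain ⟨t, ht, k, hk⟩ := hT (finHom E x)
    refine ⟨t, ht, ?_⟩
    set p : ideleGroup E := Units.map (algebraMap E (AdeleRing (𝓞 E) E) : E →* AdeleRing (𝓞 E) E) k
    have hp : p ∈ principalIdeles E := ⟨k, rfl⟩
    have hu : (ofFinite E t)⁻¹ * x * p⁻¹ ∈ unitIdeles E := by
      refine mem_unitIdeles_of_unitOrd_eq_zero fun w => ?_
      have : finHom E ((ofFinite E t)⁻¹ * x * p⁻¹) =
          finHom E x * t⁻¹ * (FiniteAdeleRing.unitEmbedding (𝓞 E) E k)⁻¹ := by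
        rw [map_mul, map_mul, map_inv, map_inv, finHom_ofFinite, finHom_principal]
        rw [mul_comm (t⁻¹) (finHom E x)]
      rw [this]; exact hk w
    have : (ofFinite E t)⁻¹ * x = (ofFinite E t)⁻¹ * x * p⁻¹ * p := by rw [inv_mul_cancel_right]
    rw [this]
    exact H.mul_mem (Subgroup.mem_sup_right hu) (Subgroup.mem_sup_left hp)
  -- hence the quotient is finite
  haveI : Finite (ideleGroup E ⧸ H) := by
    refine Finite.of_surjective (fun t : T => (QuotientGroup.mk (ofFinite E (t : (FiniteAdeleRing (𝓞 E) E)ˣ)) :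
      ideleGroup E ⧸ H)) fun q => ?_
    induction q using QuotientGroup.induction_on with
    | H x =>
      obtain ⟨t, ht, hx⟩ := hcov x
      exact ⟨⟨t, ht⟩, QuotientGroup.eq.mpr hx⟩
  exact Subgroup.index_ne_zero_of_finite

/-! ### Childress Thm. 5.11: `#Ĥ⁰(G, C_E) = [E : F] · #Ĥ⁻¹(G, C_E)` -/

omit [NumberField F] in
/-- The principal ideles are `Gal(E/F)`-stable (`σ • (a)_𝔸 = (σ a)_𝔸`).
[cite: CasselsFrohlichANT1967, Ch. VII §1.1] -/
theorem isStable_principalIdeles : Herbrand.IsStable (E ≃ₐ[F] E) (principalIdeles E) := by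
  rintro σ _ ⟨k, rfl⟩
  refine ⟨Units.map (σ : E ≃ₐ[F] E).toAlgHom.toRingHom.toMonoidHom k, Units.ext ?_⟩
  show algebraMap E (AdeleRing (𝓞 E) E) (σ (k : E)) = σ • algebraMap E (AdeleRing (𝓞 E) E) (k : E)
  rw [AdeleRing.smul_algebraMap]

variable [IsGalois F E] [FiniteDimensional F E]

/-- **Childress Thm. 5.11 (index form).**  Let `E/F` be a cyclic extension of number fields with
group `G = ⟨σ⟩` of order `n`, acting on `J_E`.  Assume (inputs proved elsewhere / hypotheses here):
`hun₀`, `hun₁` — outside the finite set `S` of finite places of `F` the local units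
`∏_{w∣v} 𝒪_wˣ` have trivial `Ĥ⁰`, `Ĥ⁻¹` (Prop. 5.7 (iii)); `hunits` — for the global units
`𝒪_Eˣ = 𝓔_E ∩ Eˣ`, `n · #Ĥ⁰ = 2^a · #Ĥ⁻¹ ≠ 0` (Prop. 5.10).  Then
`#Ĥ⁰(G; J_E, Eˣ) = n · #Ĥ⁻¹(G; J_E, Eˣ)` and `#Ĥ⁻¹(G; J_E, Eˣ) ≠ 0`, i.e. `Q(C_E) = n` with both
orders finite. [cite: Childress2009, Ch. 4 §5 Thm. 5.11 (PDF pp. 101–102)] -/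
theorem h0_top_principalIdeles_eq {σ : E ≃ₐ[F] E} (hσ : ∀ τ : E ≃ₐ[F] E, τ ∈ Subgroup.zpowers σ)
    (S : Finset (HeightOneSpectrum (𝓞 F)))
    (hun₀ : ∀ v ∉ S, ∀ z ∈ SemiLocal.unitGroup F E v, (∀ g : E ≃ₐ[F] E, g • z = z) →
      ∃ y ∈ SemiLocal.unitGroup F E v, Herbrand.norm (E ≃ₐ[F] E) y = z)
    (hun₁ : ∀ v ∉ S, ∀ z ∈ SemiLocal.unitGroup F E v, Herbrand.norm (E ≃ₐ[F] E) z = 1 →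
      ∃ y ∈ SemiLocal.unitGroup F E v, Herbrand.twist σ y = z)
    (hunits : Fintype.card (E ≃ₐ[F] E) * Herbrand.h0 σ (unitIdeles E ⊓ principalIdeles E) ⊥ =
      ArchHerbrand.archFactor F E * Herbrand.h1 σ (unitIdeles E ⊓ principalIdeles E) ⊥)
    (hunits' : Herbrand.h1 σ (unitIdeles E ⊓ principalIdeles E) ⊥ ≠ 0) :
    Herbrand.h0 σ ⊤ (principalIdeles E) =
      Fintype.card (E ≃ₐ[F] E) * Herbrand.h1 σ ⊤ (principalIdeles E) ∧
    Herbrand.h1 σ (⊤ : Subgroup (ideleGroup E)) (principalIdeles E) ≠ 0 := by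
  -- notation
  set n := Fintype.card (E ≃ₐ[F] E) with hn
  set T := ArchHerbrand.archFactor F E with hTdef
  set X := ∏ v ∈ S, Herbrand.h0 σ (localUnitIdeles F E v) ⊥ with hXdef
  set U := unitIdeles E with hUdef
  set P := principalIdeles E with hPdef
  have hUs : Herbrand.IsStable (E ≃ₐ[F] E) U := isStable_unitIdeles
  have hPs : Herbrand.IsStable (E ≃ₐ[F] E) P := isStable_principalIdeles
  have hUEs : Herbrand.IsStable (E ≃ₐ[F] E) (U ⊓ P) := hUs.inf hPs
  have hT : T ≠ 0 := ArchHerbrand.archFactor_ne_zero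
  have hX : X ≠ 0 := prod_h0_localUnitIdeles_ne_zero hσ
  have hn0 : n ≠ 0 := Fintype.card_ne_zero
  have hU0 : Herbrand.h0 σ U ⊥ = T * X := h0_unitIdeles_eq hσ hun₀
  have hU1 : Herbrand.h1 σ U ⊥ = X := h1_unitIdeles_eq hσ hun₁
  -- `h0(UE) ≠ 0`
  have hUE0 : Herbrand.h0 σ (U ⊓ P) ⊥ ≠ 0 := by
    intro h0
    rw [h0, mul_zero] at hunits
    exact (mul_ne_zero hT hunits') hunits.symm
  -- hexagon for `⊥ ≤ U ⊓ P ≤ U`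
  have hex := Herbrand.hexagon (σ := σ) hUs hUEs Herbrand.IsStable.bot bot_le inf_le_left
  rw [hU0, hU1] at hex
  -- `n · h1(U, UE) = h0(U, UE)`
  have hkey : n * Herbrand.h1 σ U (U ⊓ P) = Herbrand.h0 σ U (U ⊓ P) := by
    have h1 : T * X * Herbrand.h1 σ (U ⊓ P) ⊥ * (n * Herbrand.h1 σ U (U ⊓ P)) =
        T * X * Herbrand.h1 σ (U ⊓ P) ⊥ * Herbrand.h0 σ U (U ⊓ P) := by
      calc T * X * Herbrand.h1 σ (U ⊓ P) ⊥ * (n * Herbrand.h1 σ U (U ⊓ P))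
          = n * (T * X * Herbrand.h1 σ (U ⊓ P) ⊥ * Herbrand.h1 σ U (U ⊓ P)) := by ring
        _ = n * (Herbrand.h0 σ (U ⊓ P) ⊥ * Herbrand.h0 σ U (U ⊓ P) * X) := by rw [hex]
        _ = (n * Herbrand.h0 σ (U ⊓ P) ⊥) * Herbrand.h0 σ U (U ⊓ P) * X := by ring
        _ = (T * Herbrand.h1 σ (U ⊓ P) ⊥) * Herbrand.h0 σ U (U ⊓ P) * X := by rw [hunits]
        _ = T * X * Herbrand.h1 σ (U ⊓ P) ⊥ * Herbrand.h0 σ U (U ⊓ P) := by ring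
    exact Nat.eq_of_mul_eq_mul_left (Nat.pos_of_ne_zero (mul_ne_zero (mul_ne_zero hT hX) hunits')) h1
  -- `h1(U, UE) ≠ 0`
  have hq1 : Herbrand.h1 σ U (U ⊓ P) ≠ 0 := by
    intro h0
    have hd := Herbrand.h1_quot_dvd_mul (σ := σ) hUs hUEs Herbrand.IsStable.bot bot_le inf_le_left
    rw [h0, zero_dvd_iff, hU1] at hd
    exact (mul_ne_zero hUE0 hX) hd
  -- second isomorphism: `hⁱ(U ⊔ P, P) = hⁱ(U, U ⊓ P)`
  have hs0 : Herbrand.h0 σ (U ⊔ P) P = Herbrand.h0 σ U (U ⊓ P) := Herbrand.h0_sup_eq hUs hPs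
  have hs1 : Herbrand.h1 σ (U ⊔ P) P = Herbrand.h1 σ U (U ⊓ P) := Herbrand.h1_sup_eq hUs hPs
  -- Cor. 4.4 for the finite index `[⊤ : U ⊔ P]`
  have hfin : (U ⊔ P).relIndex (⊤ : Subgroup (ideleGroup E)) ≠ 0 := by
    rw [Subgroup.relIndex_top_right, sup_comm]
    exact index_principalIdeles_sup_unitIdeles_ne_zero
  have hcor := Herbrand.h0_mul_h1_eq_of_relIndex_ne_zero (σ := σ) Herbrand.IsStable.top (hUs.sup hPs) hPs
    le_sup_right le_top hfin
  rw [hs0, hs1, ← hkey] at hcor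
  have hne : Herbrand.h1 σ (⊤ : Subgroup (ideleGroup E)) P ≠ 0 := by
    rw [Herbrand.h1_ne_zero_iff_of_relIndex_ne_zero (σ := σ) Herbrand.IsStable.top (hUs.sup hPs) hPs
      le_sup_right le_top hfin, hs1]
    exact hq1
  refine ⟨?_, hne⟩
  -- cancel `h1(U, UE)`
  have : Herbrand.h1 σ U (U ⊓ P) * Herbrand.h0 σ ⊤ P =
      Herbrand.h1 σ U (U ⊓ P) * (n * Herbrand.h1 σ ⊤ P) := by
    calc Herbrand.h1 σ U (U ⊓ P) * Herbrand.h0 σ ⊤ P = Herbrand.h0 σ ⊤ P * Herbrand.h1 σ U (U ⊓ P) := by ring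
      _ = n * Herbrand.h1 σ U (U ⊓ P) * Herbrand.h1 σ ⊤ P := hcor
      _ = Herbrand.h1 σ U (U ⊓ P) * (n * Herbrand.h1 σ ⊤ P) := by ring
  exact Nat.eq_of_mul_eq_mul_left (Nat.pos_of_ne_zero hq1) this

end IdeleHerbrand

end Literature.NumberTheory.GaloisRepresentations
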